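import Summits.AnomalousDissipation.AnomalousDissipation.Theses.EnsembleRigidity
import Summits.AnomalousDissipation.AnomalousDissipation.Theorems.ResidualTransferSSS.Negative.LaminarAtoms
import Literature.Analysis.FluidPDE.StatisticalSolutionEnergyEq

/-!
# Negative knowledge for the crux `ResidualTransferSSS` (stmt-AnomalousDissipation-15510), II:
# the defect bound (b) is sharp; the Liouville equation and the sign of `ν` are load-bearing; the pointwise
# strengthening is false; the integrability hypothesis is decoration

Crux `EnsembleRigidity.ResidualTransferSSS` (route `AnomalousDissipation/EnsembleRigidity`, rank 4): for `ν > 0`,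
an admissible force `f` and a stationary statistical solution `μ` of `NS_ν(f)` with integrable energy, (a) the
work is non-negative on every energy shell and (b)
`|∫ ⟨F₀(v), Φ'(v)⟩ dμ| ≤ ν (∫‖∇v‖² dμ)^{1/2} (∫ ‖∇Φ'(v)‖² dμ)^{1/2}` for every cylindrical `Φ`.
This file (cdisprove seat `refuter-cdisprove-stmt-AnomalousDissipation-15510-0`) certifies what the laminar atoms
of part I (`Negative/LaminarAtoms.lean`) say about it; nothing here asserts a Theses statement.

* `residualTransferSSS_tight` — (b) holds with EQUALITY and non-zero sides at the laminar Dirac mass with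
  `Φ'(u) = f`: the constant `1` cannot be improved (`not_residualTransferSSS_sharper`: the `θ < 1` version is
  false, Kolmogorov witness) — any proof of (b) is Cauchy–Schwarz-sharp;
* `residualTransferSSS_false_without_liouville` — for probability measures with (1.29), (1.31) and integrable
  energy but WITHOUT the Liouville equation (1.30), (b) fails (Dirac at a sub-laminar ray state): any proof of
  (b) must use (1.30) — while (a) needs only (1.29) + (1.31) (refuter evidence `PartA.lean` on the item);
* `residualTransferSSS_false_without_pos`, `antiLaminar_work_neg` — with the hypothesis `0 < ν` deleted the
  statement is false (`ν = -1`: the anti-laminar Dirac mass is a "stationary statistical solution"; (a) AND (b)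
  fail); `residualTransferSSS_zero_viscosity` — at `ν = 0` both conclusions are trivial, so `0 < ν` may be
  weakened to `0 ≤ ν` but not dropped;
* `not_pointwise_defectBound` — the single-field strengthening of (b) without the Liouville constraint ("for
  every `u ∈ V` and `w ∈ 𝒱`") is false: the defect bound is a property of the MEASURE, not of states;
* `residualTransferSSS_drop_integrable` — `Integrable (‖·‖²) μ` follows from (1.29) (Poincaré on `H`; tree lemma
  `Torus.IsStationaryStatisticalSolution.integrable_norm_sq`), so the crux implies its variant without that hypothesis.
-/

noncomputable section

open MeasureTheory UnitAddTorus Matrix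
open scoped InnerProductSpace ENNReal ComplexConjugate

namespace Summit.AnomalousDissipation.AnomalousDissipation.Theorems.ResidualTransferSSS.Negative

open Literature.Analysis.FunctionSpaces Literature.Analysis.FluidPDE
open Summit.AnomalousDissipation.AnomalousDissipation.Theorems.TaylorCertificatePair.Negative
open Summit.AnomalousDissipation.AnomalousDissipation.Theorems.EnsembleCeiling.Negative

variable {k : Fin 3 → ℤ} {z : EuclideanSpace ℂ (Fin 3)}

/-! ### Tightness: the constant `1` in (b) is attained -/

/-- **The defect bound (b) of `ResidualTransferSSS` is sharp.** For every transversal mode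
`f = Re(e_k z)` (`k ≠ 0`, `k·z = 0`, `z ≠ 0`) and every `ν > 0` there are a stationary statistical solution
`μ` of `NS_ν(f)` with integrable energy (the Dirac mass at the laminar state `f/(4π²|k|²ν)`) and a
cylindrical test functional `Φ` (with `Φ'(u) = f`) for which (b) holds with EQUALITY and both sides are
non-zero (`= ½‖z‖² = ‖f‖₂²`): residual × roughness = dissipation exactly, with no room in the constant. -/
theorem residualTransferSSS_tight (hk : k ≠ 0) (hz : ((fun j => ((k) j : ℂ)) ⬝ᵥ (WithLp.ofLp z)) = 0) (hz0 : z ≠ 0)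
    {ν : ℝ} (hν : 0 < ν) :
    ∃ (μ : Measure (Torus.energySpace (Fin 3))) (Φ : Torus.CylindricalTest (Fin 3)),
      Torus.IsStationaryStatisticalSolution ν (Torus.realTrigPoly {k} (fun _ => z)) μ ∧
      Integrable (fun v : (Torus.energySpace (Fin 3)) => ‖v‖ ^ 2) μ ∧
      |∫ v, Torus.nsGeneratorPairing 0 (Torus.realTrigPoly {k} (fun _ => z)) v (Φ.grad v) ∂μ| =
        ν * Real.sqrt (Torus.ensembleEnstrophy μ).toReal * Real.sqrt (∫ v, Torus.gradNormSq (Φ.grad v) ∂μ) ∧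
      0 < |∫ v, Torus.nsGeneratorPairing 0 (Torus.realTrigPoly {k} (fun _ => z)) v (Φ.grad v) ∂μ| := by
  haveI : MeasurableSingletonClass (Torus.energySpace (Fin 3)) := OpensMeasurableSpace.toMeasurableSingletonClass
  have hkpos : 0 < Torus.freqNormSq k := lt_of_lt_of_le one_pos (Torus.one_le_freqNormSq_of_ne_zero hk)
  set c : ℝ := (ν * (4 * Real.pi ^ 2 * Torus.freqNormSq k))⁻¹ with hc
  have hcpos : 0 < c := by positivity
  have hνc : ν * (4 * Real.pi ^ 2 * Torus.freqNormSq k) * c = 1 := by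
    rw [hc]; field_simp
  obtain ⟨u, hu, hV⟩ := exists_rayState hk hz c
  obtain ⟨Φ, hΦ⟩ := exists_cylindricalTest_grad_eq u (isSmooth_mode k z)
    (Torus.isDivFree_realTrigPoly_singleton hz) (hasZeroMean_mode hk z)
  refine ⟨Measure.dirac u, Φ, ray_dirac_isStationary hz hu hk hV hνc, Torus.integrable_dirac u _, ?_, ?_⟩
  · rw [ray_defect_lhs hk hz hu hΦ, ray_defect_rhs hk hcpos.le hu hΦ ν, hνc, one_mul]
  · rw [ray_defect_lhs hk hz hu hΦ]
    have : 0 < ‖z‖ := norm_pos_iff.2 hz0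
    positivity

/-- **No constant below `1` in (b), at any fixed viscosity.** For every `ν > 0` and `θ < 1` the strengthening
of (b) by the factor `θ` already fails among the stationary statistical solutions of `NS_ν` of the Kolmogorov
mode `cos(2πx₂)e₀`: at its laminar Dirac mass the two sides of (b) are equal and positive
(`residualTransferSSS_tight`). Any proof of (b) must be Cauchy–Schwarz sharp (no slack to absorb, e.g., a
Poincaré or interpolation loss), uniformly in `ν`. -/
theorem not_residualTransferSSS_sharper_at {ν θ : ℝ} (hν : 0 < ν) (hθ : θ < 1) :
    ¬ ∀ (f : (UnitAddTorus (Fin 3) → EuclideanSpace ℝ (Fin 3))) (μ : Measure (Torus.energySpace (Fin 3))),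
        Torus.IsSmooth f → Torus.IsDivFree f → Torus.HasZeroMean f →
        Torus.IsStationaryStatisticalSolution ν f μ →
        Integrable (fun v : (Torus.energySpace (Fin 3)) => ‖v‖ ^ 2) μ →
        ∀ Φ : Torus.CylindricalTest (Fin 3),
          |∫ v, Torus.nsGeneratorPairing 0 f v (Φ.grad v) ∂μ| ≤
            θ * (ν * Real.sqrt (Torus.ensembleEnstrophy μ).toReal *
              Real.sqrt (∫ v, Torus.gradNormSq (Φ.grad v) ∂μ)) := by
  intro h
  obtain ⟨hs, hd, hm, -⟩ := singleMode_admissible e2_ne_zero dotc_e2_zhat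
  obtain ⟨μ, Φ, hμ, hint, heq, hpos⟩ := residualTransferSSS_tight e2_ne_zero dotc_e2_zhat zhat_ne_zero hν
  have h1 := h _ μ hs hd hm hμ hint Φ
  rw [← heq] at h1
  nlinarith

/-- **No constant below `1` in (b)** (the `θ < 1` strengthening of `ResidualTransferSSS` is false). -/
theorem not_residualTransferSSS_sharper {θ : ℝ} (hθ : θ < 1) :
    ¬ ∀ (ν : ℝ) (f : (UnitAddTorus (Fin 3) → EuclideanSpace ℝ (Fin 3))) (μ : Measure (Torus.energySpace (Fin 3))), 0 < ν → Torus.IsSmooth f → Torus.IsDivFree f →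
        Torus.HasZeroMean f → Torus.IsStationaryStatisticalSolution ν f μ →
        Integrable (fun v : (Torus.energySpace (Fin 3)) => ‖v‖ ^ 2) μ →
        ∀ Φ : Torus.CylindricalTest (Fin 3),
          |∫ v, Torus.nsGeneratorPairing 0 f v (Φ.grad v) ∂μ| ≤
            θ * (ν * Real.sqrt (Torus.ensembleEnstrophy μ).toReal *
              Real.sqrt (∫ v, Torus.gradNormSq (Φ.grad v) ∂μ)) :=
  fun h => not_residualTransferSSS_sharper_at one_pos hθ fun f μ hs hd hm hμ hint => h 1 f μ one_pos hs hd hm hμ hint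

/-! ### Load-bearing hypotheses: the Liouville equation (1.30) and the sign of `ν` -/

/-- **Any proof of (b) must use the stationary Liouville equation (1.30).** The variant of
`ResidualTransferSSS` in which `IsStationaryStatisticalSolution ν f μ` is replaced by its other clauses —
`μ` a probability measure with finite mean enstrophy (1.29) and the shell energy inequalities (1.31) — is
FALSE: at `ν = ½`, the Kolmogorov mode `f` and the Dirac mass at the laminar state OF VISCOSITY `1`
(a sub-laminar ray state for `ν = ½`: (1.29), (1.31), integrable energy hold) the defect bound (b) reads
`½ ≤ ¼`. (Conjunct (a), by contrast, follows from (1.29) + (1.31) alone.) -/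
theorem residualTransferSSS_false_without_liouville :
    ¬ ∀ (ν : ℝ) (f : (UnitAddTorus (Fin 3) → EuclideanSpace ℝ (Fin 3))) (μ : Measure (Torus.energySpace (Fin 3))), 0 < ν → Torus.IsSmooth f → Torus.IsDivFree f →
        Torus.HasZeroMean f → IsProbabilityMeasure μ →
        ∫⁻ v, Torus.eGradNormSq (((v : (Torus.energySpace (Fin 3))) : (Lp (EuclideanSpace ℝ (Fin 3)) 2 (volume : Measure (UnitAddTorus (Fin 3))))) : (UnitAddTorus (Fin 3) → EuclideanSpace ℝ (Fin 3))) ∂μ < ∞ →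
        (∀ e₁ e₂ : ℝ≥0∞, e₁ < e₂ →
          ∫ v in {v : (Torus.energySpace (Fin 3)) | e₁ ≤ ‖v‖ₑ ^ 2 ∧ ‖v‖ₑ ^ 2 < e₂},
            (ν * (Torus.eGradNormSq (((v : (Torus.energySpace (Fin 3))) : (Lp (EuclideanSpace ℝ (Fin 3)) 2 (volume : Measure (UnitAddTorus (Fin 3))))) : (UnitAddTorus (Fin 3) → EuclideanSpace ℝ (Fin 3)))).toReal - Torus.pairing ((v : (Torus.energySpace (Fin 3))) : (Lp (EuclideanSpace ℝ (Fin 3)) 2 (volume : Measure (UnitAddTorus (Fin 3))))) f) ∂μ ≤ 0) →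
        Integrable (fun v : (Torus.energySpace (Fin 3)) => ‖v‖ ^ 2) μ →
        (∀ e₁ e₂ : ℝ≥0∞, e₁ < e₂ →
            0 ≤ ∫ v in {v : (Torus.energySpace (Fin 3)) | e₁ ≤ ‖v‖ₑ ^ 2 ∧ ‖v‖ₑ ^ 2 < e₂}, Torus.pairing ((v : (Torus.energySpace (Fin 3))) : (Lp (EuclideanSpace ℝ (Fin 3)) 2 (volume : Measure (UnitAddTorus (Fin 3))))) f ∂μ) ∧
          ∀ Φ : Torus.CylindricalTest (Fin 3),
            Integrable (fun v : (Torus.energySpace (Fin 3)) => Torus.nsGeneratorPairing 0 f v (Φ.grad v)) μ ∧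
            |∫ v, Torus.nsGeneratorPairing 0 f v (Φ.grad v) ∂μ| ≤
              ν * Real.sqrt (Torus.ensembleEnstrophy μ).toReal *
                Real.sqrt (∫ v, Torus.gradNormSq (Φ.grad v) ∂μ) := by
  intro h
  obtain ⟨hs, hd, hm, -⟩ := singleMode_admissible e2_ne_zero dotc_e2_zhat
  set c : ℝ := (4 * Real.pi ^ 2)⁻¹ with hc
  have hcpos : 0 < c := by positivity
  have hνc : (2⁻¹ : ℝ) * (4 * Real.pi ^ 2 * Torus.freqNormSq (![0, 1, 0] : Fin 3 → ℤ)) * c = 2⁻¹ := by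
    rw [freqNormSq_e2, hc]; field_simp
  obtain ⟨u, hu, -⟩ := exists_rayState e2_ne_zero dotc_e2_zhat c
  obtain ⟨Φ, hΦ⟩ := exists_cylindricalTest_grad_eq u (isSmooth_mode _ _)
    (Torus.isDivFree_realTrigPoly_singleton dotc_e2_zhat) (hasZeroMean_mode e2_ne_zero _)
  obtain ⟨hprob, h29, h31, hint⟩ := ray_dirac_subStationary hu e2_ne_zero (ν := 2⁻¹) hcpos.le (by rw [hνc]; norm_num)
  have hb := ((h 2⁻¹ _ (Measure.dirac u) (by norm_num) hs hd hm hprob h29 h31 hint).2 Φ).2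
  rw [ray_defect_lhs e2_ne_zero dotc_e2_zhat hu hΦ, ray_defect_rhs e2_ne_zero hcpos.le hu hΦ, hνc, norm_zhat] at hb
  norm_num at hb

/-- **The sign of `ν` is load-bearing; `ν > 0` cannot simply be deleted.** With the hypothesis `0 < ν`
removed, `ResidualTransferSSS` is false: at `ν = -1` the Dirac mass at the anti-laminar state
`-f/(4π²|k|²)` of the Kolmogorov mode IS a stationary statistical solution in the sense of FMRT IV
Def. 1.3 (all three clauses hold; the definition carries no sign), its work is negative (so (a) fails,
`antiLaminar_work_neg`) and its Euler defect is `½ > 0 ≥` the right-hand side of (b). At `ν = 0` both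
conclusions are trivial consequences of (1.30)–(1.31) (`residualTransferSSS_zero_viscosity`), so the
hypothesis may be weakened to `0 ≤ ν`. -/
theorem residualTransferSSS_false_without_pos :
    ¬ ∀ (ν : ℝ) (f : (UnitAddTorus (Fin 3) → EuclideanSpace ℝ (Fin 3))) (μ : Measure (Torus.energySpace (Fin 3))), Torus.IsSmooth f → Torus.IsDivFree f →
        Torus.HasZeroMean f → Torus.IsStationaryStatisticalSolution ν f μ →
        Integrable (fun v : (Torus.energySpace (Fin 3)) => ‖v‖ ^ 2) μ →
        (∀ e₁ e₂ : ℝ≥0∞, e₁ < e₂ →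
            0 ≤ ∫ v in {v : (Torus.energySpace (Fin 3)) | e₁ ≤ ‖v‖ₑ ^ 2 ∧ ‖v‖ₑ ^ 2 < e₂}, Torus.pairing ((v : (Torus.energySpace (Fin 3))) : (Lp (EuclideanSpace ℝ (Fin 3)) 2 (volume : Measure (UnitAddTorus (Fin 3))))) f ∂μ) ∧
          ∀ Φ : Torus.CylindricalTest (Fin 3),
            Integrable (fun v : (Torus.energySpace (Fin 3)) => Torus.nsGeneratorPairing 0 f v (Φ.grad v)) μ ∧
            |∫ v, Torus.nsGeneratorPairing 0 f v (Φ.grad v) ∂μ| ≤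
              ν * Real.sqrt (Torus.ensembleEnstrophy μ).toReal *
                Real.sqrt (∫ v, Torus.gradNormSq (Φ.grad v) ∂μ) := by
  intro h
  haveI : MeasurableSingletonClass (Torus.energySpace (Fin 3)) := OpensMeasurableSpace.toMeasurableSingletonClass
  obtain ⟨hs, hd, hm, -⟩ := singleMode_admissible e2_ne_zero dotc_e2_zhat
  set c : ℝ := -(4 * Real.pi ^ 2)⁻¹ with hc
  have hνc : (-1 : ℝ) * (4 * Real.pi ^ 2 * Torus.freqNormSq (![0, 1, 0] : Fin 3 → ℤ)) * c = 1 := by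
    rw [freqNormSq_e2, hc]; field_simp
  obtain ⟨u, hu, hV⟩ := exists_rayState e2_ne_zero dotc_e2_zhat c
  obtain ⟨Φ, hΦ⟩ := exists_cylindricalTest_grad_eq u (isSmooth_mode _ _)
    (Torus.isDivFree_realTrigPoly_singleton dotc_e2_zhat) (hasZeroMean_mode e2_ne_zero _)
  have hμ := ray_dirac_isStationary dotc_e2_zhat hu e2_ne_zero hV hνc
  have hb := ((h (-1) _ (Measure.dirac u) hs hd hm hμ (Torus.integrable_dirac u _)).2 Φ).2
  rw [ray_defect_lhs e2_ne_zero dotc_e2_zhat hu hΦ, norm_zhat] at hb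
  have hnonpos : (-1 : ℝ) * Real.sqrt (Torus.ensembleEnstrophy (Measure.dirac u)).toReal *
      Real.sqrt (∫ v, Torus.gradNormSq (Φ.grad v) ∂(Measure.dirac u)) ≤ 0 := by
    have h1 := Real.sqrt_nonneg (Torus.ensembleEnstrophy (Measure.dirac u)).toReal
    have h2 := Real.sqrt_nonneg (∫ v, Torus.gradNormSq (Φ.grad v) ∂(Measure.dirac u))
    nlinarith [mul_nonneg h1 h2]
  have h3 := hb.trans hnonpos
  norm_num at h3

/-- At `ν = -1` conjunct (a) fails as well: the anti-laminar Dirac mass does NEGATIVE work,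
`∫_{0 ≤ |v|² < ∞} (v, f) dδ_u = (u, f) = -1/(8π²) < 0`. -/
theorem antiLaminar_work_neg :
    ∃ (f : (UnitAddTorus (Fin 3) → EuclideanSpace ℝ (Fin 3))) (μ : Measure (Torus.energySpace (Fin 3))), Torus.IsSmooth f ∧ Torus.IsDivFree f ∧ Torus.HasZeroMean f ∧
      Torus.IsStationaryStatisticalSolution (-1) f μ ∧ Integrable (fun v : (Torus.energySpace (Fin 3)) => ‖v‖ ^ 2) μ ∧
      ∫ v in {v : (Torus.energySpace (Fin 3)) | (0 : ℝ≥0∞) ≤ ‖v‖ₑ ^ 2 ∧ ‖v‖ₑ ^ 2 < ⊤}, Torus.pairing ((v : (Torus.energySpace (Fin 3))) : (Lp (EuclideanSpace ℝ (Fin 3)) 2 (volume : Measure (UnitAddTorus (Fin 3))))) f ∂μ < 0 := by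
  haveI : MeasurableSingletonClass (Torus.energySpace (Fin 3)) := OpensMeasurableSpace.toMeasurableSingletonClass
  obtain ⟨hs, hd, hm, -⟩ := singleMode_admissible e2_ne_zero dotc_e2_zhat
  set c : ℝ := -(4 * Real.pi ^ 2)⁻¹ with hc
  have hcneg : c < 0 := by rw [hc]; exact neg_neg_of_pos (by positivity)
  have hνc : (-1 : ℝ) * (4 * Real.pi ^ 2 * Torus.freqNormSq (![0, 1, 0] : Fin 3 → ℤ)) * c = 1 := by
    rw [freqNormSq_e2, hc]; field_simp
  obtain ⟨u, hu, hV⟩ := exists_rayState e2_ne_zero dotc_e2_zhat c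
  refine ⟨_, Measure.dirac u, hs, hd, hm, ray_dirac_isStationary dotc_e2_zhat hu e2_ne_zero hV hνc,
    Torus.integrable_dirac u _, ?_⟩
  classical
  rw [setIntegral_dirac, if_pos, ray_pairing hu e2_ne_zero, norm_zhat]
  · nlinarith
  · exact ⟨zero_le, (ENNReal.pow_ne_top enorm_ne_top).lt_top⟩

/-- **`ν = 0` is harmless** (so `0 < ν` may be weakened to `0 ≤ ν`): for a stationary statistical solution
at `ν = 0` both conclusions of the crux are immediate from (1.31) (whose viscous term vanishes) and (1.30). -/
theorem residualTransferSSS_zero_viscosity (f : (UnitAddTorus (Fin 3) → EuclideanSpace ℝ (Fin 3))) (μ : Measure (Torus.energySpace (Fin 3)))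
    (hμ : Torus.IsStationaryStatisticalSolution 0 f μ) :
    (∀ e₁ e₂ : ℝ≥0∞, e₁ < e₂ →
        0 ≤ ∫ v in {v : (Torus.energySpace (Fin 3)) | e₁ ≤ ‖v‖ₑ ^ 2 ∧ ‖v‖ₑ ^ 2 < e₂}, Torus.pairing ((v : (Torus.energySpace (Fin 3))) : (Lp (EuclideanSpace ℝ (Fin 3)) 2 (volume : Measure (UnitAddTorus (Fin 3))))) f ∂μ) ∧
      ∀ Φ : Torus.CylindricalTest (Fin 3),
        Integrable (fun v : (Torus.energySpace (Fin 3)) => Torus.nsGeneratorPairing 0 f v (Φ.grad v)) μ ∧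
        |∫ v, Torus.nsGeneratorPairing 0 f v (Φ.grad v) ∂μ| ≤
          0 * Real.sqrt (Torus.ensembleEnstrophy μ).toReal * Real.sqrt (∫ v, Torus.gradNormSq (Φ.grad v) ∂μ) := by
  refine ⟨fun e₁ e₂ he => ?_, fun Φ => ⟨(hμ.generator Φ).1, ?_⟩⟩
  · have h := hμ.energy_ineq e₁ e₂ he
    simp only [zero_mul, zero_sub] at h
    rw [integral_neg] at h
    linarith
  · rw [(hμ.generator Φ).2, abs_zero, zero_mul, zero_mul]

/-! ### The pointwise strengthening is false -/

/-- **The defect bound is a property of the measure, not of states.** The single-field strengthening of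
(b) without the steady-state / Liouville constraint — "for every `ν > 0`, admissible `f`, finite-enstrophy
`u ∈ H` and test field `w ∈ 𝒱`, `|⟨F₀(u), w⟩| ≤ ν ‖u‖_V ‖∇w‖`" — is FALSE: at half the laminar
amplitude of the Kolmogorov mode (`u = f/(8π²)`, `w = f`, `ν = 1`) it reads `½ ≤ ¼`. (For steady weak
solutions `u` it is true — VirtualDissipation's single-field lever — and (b) is its average over (1.30).) -/
theorem not_pointwise_defectBound :
    ¬ ∀ (ν : ℝ) (f : (UnitAddTorus (Fin 3) → EuclideanSpace ℝ (Fin 3))) (u : (Torus.energySpace (Fin 3))) (w : (UnitAddTorus (Fin 3) → EuclideanSpace ℝ (Fin 3))), 0 < ν → Torus.IsSmooth f → Torus.IsDivFree f →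
        Torus.HasZeroMean f → Torus.eGradNormSq (((u : (Torus.energySpace (Fin 3))) : (Lp (EuclideanSpace ℝ (Fin 3)) 2 (volume : Measure (UnitAddTorus (Fin 3))))) : (UnitAddTorus (Fin 3) → EuclideanSpace ℝ (Fin 3))) < ⊤ → Torus.IsSmooth w →
        Torus.IsDivFree w → Torus.HasZeroMean w →
        |Torus.nsGeneratorPairing 0 f u w| ≤
          ν * Real.sqrt (Torus.eGradNormSq (((u : (Torus.energySpace (Fin 3))) : (Lp (EuclideanSpace ℝ (Fin 3)) 2 (volume : Measure (UnitAddTorus (Fin 3))))) : (UnitAddTorus (Fin 3) → EuclideanSpace ℝ (Fin 3)))).toReal * Real.sqrt (Torus.gradNormSq w) := by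
  intro h
  obtain ⟨hs, hd, hm, -⟩ := singleMode_admissible e2_ne_zero dotc_e2_zhat
  set c : ℝ := (8 * Real.pi ^ 2)⁻¹ with hc
  have hcpos : 0 < c := by positivity
  have hνc : (1 : ℝ) * (4 * Real.pi ^ 2 * Torus.freqNormSq (![0, 1, 0] : Fin 3 → ℤ)) * c = 2⁻¹ := by
    rw [freqNormSq_e2, hc]; field_simp; norm_num
  obtain ⟨u, hu, -⟩ := exists_rayState e2_ne_zero dotc_e2_zhat c
  have h1 := h 1 _ u _ one_pos hs hd hm (ray_eGradNormSq_lt_top hu) hs hd hm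
  rw [ray_eulerDefect_self dotc_e2_zhat hu e2_ne_zero, ray_defect_rhs_state e2_ne_zero hcpos.le hu 1, hνc,
    norm_zhat, abs_of_nonneg (by norm_num)] at h1
  norm_num at h1

/-! ### The integrability hypothesis is decoration -/

/-- **`ResidualTransferSSS` implies its variant without the hypothesis `Integrable (‖·‖²) μ`**
(the converse is trivial): finite mean enstrophy (1.29) and Poincaré on `H` give integrable energy
(`Torus.IsStationaryStatisticalSolution.integrable_norm_sq`), so provers may ignore that hypothesis and refuters
cannot exploit it. -/
theorem residualTransferSSS_drop_integrable
    (h : Summit.AnomalousDissipation.AnomalousDissipation.Theses.EnsembleRigidity.ResidualTransferSSS) :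
    ∀ (ν : ℝ) (f : (UnitAddTorus (Fin 3) → EuclideanSpace ℝ (Fin 3))) (μ : Measure (Torus.energySpace (Fin 3))), 0 < ν → Torus.IsSmooth f → Torus.IsDivFree f →
        Torus.HasZeroMean f → Torus.IsStationaryStatisticalSolution ν f μ →
        (∀ e₁ e₂ : ℝ≥0∞, e₁ < e₂ →
            0 ≤ ∫ v in {v : (Torus.energySpace (Fin 3)) | e₁ ≤ ‖v‖ₑ ^ 2 ∧ ‖v‖ₑ ^ 2 < e₂}, Torus.pairing ((v : (Torus.energySpace (Fin 3))) : (Lp (EuclideanSpace ℝ (Fin 3)) 2 (volume : Measure (UnitAddTorus (Fin 3))))) f ∂μ) ∧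
          ∀ Φ : Torus.CylindricalTest (Fin 3),
            Integrable (fun v : (Torus.energySpace (Fin 3)) => Torus.nsGeneratorPairing 0 f v (Φ.grad v)) μ ∧
            |∫ v, Torus.nsGeneratorPairing 0 f v (Φ.grad v) ∂μ| ≤
              ν * Real.sqrt (Torus.ensembleEnstrophy μ).toReal *
                Real.sqrt (∫ v, Torus.gradNormSq (Φ.grad v) ∂μ) :=
  fun ν f μ hν hs hd hm hμ => h ν f μ hν hs hd hm hμ hμ.integrable_norm_sq

end Summit.AnomalousDissipation.AnomalousDissipation.Theorems.ResidualTransferSSS.Negative
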